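import Summits.BirchSwinnertonDyer.BirchSwinnertonDyer.Theorems.PrintX9MuPartStubH5bAtSOfNonanomalous
import Literature.NumberTheory.EllipticCurves.AnticyclotomicHeegnerPlacesDecompositionProofs
import Literature.NumberTheory.EllipticCurves.ZpExtensionEisensteinOrdinaryInvariantsBoundProofs
import HarnessLib

/-!
# The registered stub `stub_h5bAtSZeroP : Stmt.h5bAtSZeroP` (skeleton v8 on μP-CG) from a threshold-explicit level-`0`
# clause above `p` — the FRAME PACKAGING of road U's F7 (theorems only)

Summits-side helper for the line `spec_witnesses` on the shared deciding μ-crux μP-CG `MuInequalityCoherentPairOfPrintCG`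
(stmt-BirchSwinnertonDyer-23428; skeleton v8 of μ-LEAD `bsd-line-x9-p1` g4, 22:22:31Z, registered stub
**`stub_h5bAtSZeroP : Stmt.h5bAtSZeroP`** = x10b-p1-w8 g3's letter, p670626 l.69–125); cell `pub/bsd-print-x9`, seat
`bsd-line-x10b-p1-w8` g3 (the `k = 0` assembler lineage, OWNER of the stub's assembly per v8).  `--supports`
stmt-BirchSwinnertonDyer-23428.  THEOREMS ONLY (no definition, no named fact, no instance, no `sorry`).

`Stmt.h5bAtSZeroP`: on every frame of the μ-letter and every `v ∈ S` above `p` there is `m₁` such that for all `m > m₁` and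
all the data of the canonical Eisenstein setting the H.5(b) clause holds at tower level `0`.  Road U of x9-p1-w3 g6 (uniform
Iwasawa-involution road for (H5B-P-ANOM)) delivers that clause at ONE place in the THRESHOLD-EXPLICIT shape requested by this
seat (STATUS 21:55Z, shape (b); F7b `WeierstrassCurve.eisensteinDVRSetting_h5b_clause_zero_of_mem_p`, announced 22:28:16Z):
the section variables of C2b (`…SelmerH5bOrdinaryPlacesProofs`), then `hpv`, `hpσv`, `hgood`/`hord` at `w ∈ {v, σ v}`, `hanti`,
the (B4) elements `κ(g_w) = p^{s_w}` and the NUMERIC thresholds `5 p^{s_w} + 1 ≤ m` — nothing depending on the conjugation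
datum / `𝓛` / `D` / `fs` inside the threshold.  This file does the frame plumbing ONCE, against that shape taken as the
hypothesis `HF7`:
* **`h5bAtSZeroP_of_clauseP`** — `HF7 → Stmt.h5bAtSZeroP` (letter verbatim): per frame, every `w ∈ S` is finitely decomposed in
  `K_∞^−/K` (x9-p1-w3/x9-p2's `decomp_not_le_kerSubgroup_of_mem_or_mem`: above `p` by Brink Cor. 1, over `N` by (Heeg)), whence
  the (B4) elements (`ZpExtension.exists_toAdd_apply_absGaloisRestrict_eq_pow_of_not_decomp_le`) and `m₁ := S.sup (5 p^{s_w} + 1)`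
  (`choose!`, `Finset.le_sup`); `hgood`/`hord` from `hyp.ordinary` (ordinary ascent + the ordinary point, as in
  `clauseZeroP_frame_of_nonanomalous`); `hanti` for `κ⁻ = κ.unitTwist (-1)` and the transported complex conjugation
  (`ZpExtension.toAdd_conjGalCMH_eq_neg`); `σ v ∈ S` (`σ² = 1`), `p ∈ σ v` (`natCast_mem_smul_asIdeal_iff`).
⇒ `theorem stub_h5bAtSZeroP : Stmt.h5bAtSZeroP := h5bAtSZeroP_of_clauseP <F7b>` the moment F7b lands.  HONEST FRAMING: the
`v ∣ p` clause itself (road U) is NOT proved here; no summit statement is proved; the μ-crux is not asserted; BSD is not proved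
by any of this.

References: [Howard2004HeegnerKolyvagin] §1.3 H.5(b), §2.2, Def. 3.1.2, §3.1 (arXiv:1202.6340 p. 7 L96–97, p. 15–16);
[CastellaGrossiLeeSkinner2022] §3.2, §3.4; [Brink2007] Thm. 2, Cor. 1; [GreenbergLNM1716] §2; [SilvermanAEC2009] V.2.3.1, VII.5.1.
-/

set_option linter.dupNamespace false
set_option autoImplicit false

noncomputable section

open scoped Classical Pointwise ContRepresentation TensorProduct NumberField

open Function NumberField IsDedekindDomain Field
open Literature Literature.NumberTheory.EllipticCurves WeierstrassCurve
open Literature.NumberTheory.GaloisCohomology Literature.NumberTheory.GaloisCohomology.Howard2004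
open Literature.NumberTheory.Automorphic
open Literature.NumberTheory.GaloisRepresentations Literature.NumberTheory.GaloisRepresentations.DiscreteGaloisModule
open Summit.BirchSwinnertonDyer.BirchSwinnertonDyer.Theorems

namespace Summit.BirchSwinnertonDyer.BirchSwinnertonDyer.Theorems.HeegnerMuPartH5bAtS

set_option synthInstance.maxHeartbeats 80000 in
/-- **`Stmt.h5bAtSZeroP` from a threshold-explicit level-`0` clause above `p`** (hypothesis `HF7` = road U's F7b shape: C2b's
section variables, `hpv`, `hpσv`, `hgood`/`hord` at `w ∈ {v, σ v}`, `hanti`, (B4) elements `κ(g_w) = p^{s_w}` and numeric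
thresholds `5 p^{s_w} + 1 ≤ m`): the frame plumbing — finite decomposition of every `w ∈ S` in `K_∞^−` (Brink / (Heeg)),
`m₁ := max_{w ∈ S} (5 p^{s_w} + 1)`, good ORDINARY reduction at `w ∣ p` from `hyp.ordinary`, anticyclotomy of `κ⁻` along the
transported complex conjugation, `σ`-stability of `S`.
[cite: Howard2004HeegnerKolyvagin, §1.3 H.5(b), §2.2, Def. 3.1.2 (arXiv:1202.6340 p. 7 L96–97)] [cite: Brink2007, Thm. 2 and Cor. 1]
[cite: CastellaGrossiLeeSkinner2022, §3.2 and §3.4] [cite: SilvermanAEC2009, Thm. V.2.3.1 and Prop. VII.5.1(a)] -/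
theorem h5bAtSZeroP_of_clauseP
    (HF7 :
      ∀ {K : Type} [Field K] [NumberField K] (W : WeierstrassCurve ℚ) [W.IsElliptic] {p : ℕ} [Fact p.Prime]
        (κ : ZpExtension K p) {m : ℕ} (hm : 1 ≤ m)
        (S : Finset (HeightOneSpectrum (𝓞 K)))
        (hpS : ∀ v : HeightOneSpectrum (𝓞 K), ((p : ℕ) : 𝓞 K) ∈ v.asIdeal → v ∈ S)
        (hbad : ∀ v : HeightOneSpectrum (𝓞 K), v ∉ S → ((p : ℕ) : 𝓞 K) ∉ v.asIdeal →
          (W.baseChange K).HasGoodReductionAt v)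
        (L : Set (HeightOneSpectrum (𝓞 K)))
        (hL : letI := IwasawaAlgebra.isLocalRing_quotient_X_pow_add_C p hm
          L ⊆ (W.eisensteinTower κ hm).degreeTwoPrimes p)
        (hLS : ∀ v ∈ L, v ∉ S)
        (jbar : AlgebraicClosure K →+* ℂ)
        (σ : K ≃ₐ[ℚ] K) (hσ₁ : σ ≠ 1) (hσ : σ * σ = 1) (τ : AlgebraicClosure K ≃+* AlgebraicClosure K)
        (hτ : IsLiftOfAut σ τ) (hτ₂ : Function.Involutive τ)
        (D : letI := IwasawaAlgebra.isLocalRing_quotient_X_pow_add_C p hm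
          ∀ k, DualityDatum p (ConjugationDatum.ofLifts σ hσ₁ hσ τ hτ hτ₂) ((W.eisensteinTower κ hm).ρ k)
            (IwasawaAlgebra.EisensteinCoeff p m (k + 1)))
        (fs : letI := IwasawaAlgebra.isLocalRing_quotient_X_pow_add_C p hm
          ∀ (k : ℕ) (n : Finset (HeightOneSpectrum (𝓞 K))) (v : HeightOneSpectrum (𝓞 K)),
            galoisCohomology ((W.eisensteinLevelQuot κ hm k n).toLocal (Sum.inr v)) 1 →+
              SingularQuotient (GaloisRep.toLocal v (W.eisensteinLevelQuot κ hm k n)) ⊗[ℤ] Gell v)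
        {v : HeightOneSpectrum (𝓞 K)} (_hpv : ((p : ℕ) : 𝓞 K) ∈ v.asIdeal)
        (_hpσv : ((p : ℕ) : 𝓞 K) ∈ ((ConjugationDatum.ofLifts σ hσ₁ hσ τ hτ hτ₂).σ • v).asIdeal)
        (_hgood : ∀ w ∈ ({v, (ConjugationDatum.ofLifts σ hσ₁ hσ τ hτ hτ₂).σ • v} : Set (HeightOneSpectrum (𝓞 K))),
          (W.baseChange K).HasGoodReductionAt w)
        (_hord : ∀ w ∈ ({v, (ConjugationDatum.ofLifts σ hσ₁ hσ τ hτ hτ₂).σ • v} : Set (HeightOneSpectrum (𝓞 K))),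
          ∃ P : localPoints (W.baseChange K) (w.adicCompletion K),
            (p : ℤ) • P = 0 ∧ P ∉ (W.baseChange K).localKernelOfReduction w)
        (_hanti : ∀ g : absoluteGaloisGroup K,
          (κ ((ConjugationDatum.ofLifts σ hσ₁ hσ τ hτ hτ₂).conj g)).toAdd = -(κ g).toAdd)
        {s : HeightOneSpectrum (𝓞 K) → ℕ}
        {g : ∀ w : HeightOneSpectrum (𝓞 K), absoluteGaloisGroup (w.adicCompletion K)}
        (_hg : ∀ w ∈ ({v, (ConjugationDatum.ofLifts σ hσ₁ hσ τ hτ hτ₂).σ • v} : Set (HeightOneSpectrum (𝓞 K))),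
          (κ (absGaloisRestrict K (w.adicCompletion K) (g w))).toAdd = ((p ^ s w : ℕ) : ℤ_[p]))
        (_hms : ∀ w ∈ ({v, (ConjugationDatum.ofLifts σ hσ₁ hσ τ hτ hτ₂).σ • v} : Set (HeightOneSpectrum (𝓞 K))),
          5 * p ^ s w + 1 ≤ m),
        letI := IwasawaAlgebra.isDomain_quotient_X_pow_add_C p hm
        letI := IwasawaAlgebra.isDiscreteValuationRing_quotient_X_pow_add_C p hm
        haveI := IwasawaAlgebra.EisensteinCoeff.isLocalRing_succ p hm
        letI := IwasawaAlgebra.EisensteinCoeff.algebraOfSpecSucc p m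
        haveI := W.isScalarTower_algebraOfSpecSucc (K := K) (p := p) (m := m)
        letI := W.residueModuleSucc (K := K) (p := p) hm
        AddSubgroup.map
            (((W.residualTauGeomTorsion (p := p) (ConjugationDatum.ofLifts σ hσ₁ hσ τ hτ hτ₂) hm (k := 0 + 1)
                (Nat.succ_pos 0)).thetaH1 (Sum.inr v)).comp
              ((ConjugationDatum.ofLifts σ hσ₁ hσ τ hτ hτ₂).transportH1 ((W.baseChange K).torsionGaloisModule (p : ℤ)) v))
            (((W.isQuotientBy_eisensteinDVRSetting_πbar κ hm S hpS hbad L hL hLS jbar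
                (ConjugationDatum.ofLifts σ hσ₁ hσ τ hτ hτ₂) D fs 0).propagateStructure
              (W.eisensteinTowerTriple κ hm S hpS hbad L hL hLS 0).cond)
              (Sum.inr ((ConjugationDatum.ofLifts σ hσ₁ hσ τ hτ hτ₂).σ • v))) =
          ((W.isQuotientBy_eisensteinDVRSetting_πbar κ hm S hpS hbad L hL hLS jbar
              (ConjugationDatum.ofLifts σ hσ₁ hσ τ hτ hτ₂) D fs 0).propagateStructure
            (W.eisensteinTowerTriple κ hm S hpS hbad L hL hLS 0).cond) (Sum.inr v)
    ) :
      ∀ (N : ℕ) [NeZero N] (W : WeierstrassCurve ℚ) [W.IsGloballyMinimal] (K : Type) [Field K] [NumberField K]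
        (p : ℕ) [Fact p.Prime] (κ : ZpExtension K p) (γ : Field.absoluteGaloisGroup K)
        (hyp : CastellaGrossiLeeSkinner2022.Thm413Hypotheses N W K p κ γ),
        W.HasIrreducibleModPGaloisRep p → (W.baseChange K).HasIrreducibleModPGaloisRep p →
        haveI := hyp.isElliptic
        ∀ (S : Finset (HeightOneSpectrum (𝓞 K)))
          (hpS : ∀ v, ((p : ℕ) : 𝓞 K) ∈ v.asIdeal → v ∈ S)
          (hbad : ∀ v, v ∉ S → ((p : ℕ) : 𝓞 K) ∉ v.asIdeal → (W.baseChange K).HasGoodReductionAt v),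
        (∀ v ∈ S, ((p : ℕ) : 𝓞 K) ∈ v.asIdeal ∨ ((N : ℕ) : 𝓞 K) ∈ v.asIdeal) →
        (∀ (σ : K ≃ₐ[ℚ] K) (v : HeightOneSpectrum (𝓞 K)), σ • v ∈ S → v ∈ S) →
        ∀ v ∈ S, ((p : ℕ) : 𝓞 K) ∈ v.asIdeal →
        ∃ m₁ : ℕ, ∀ (m : ℕ) (hm : 1 ≤ m), m₁ < m →
          letI := IwasawaAlgebra.isDomain_quotient_X_pow_add_C p hm
          letI := IwasawaAlgebra.isDiscreteValuationRing_quotient_X_pow_add_C p hm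
          haveI := IwasawaAlgebra.EisensteinCoeff.isLocalRing_succ p hm
          letI := IwasawaAlgebra.EisensteinCoeff.algebraOfSpecSucc p m
          haveI := W.isScalarTower_algebraOfSpecSucc (K := K) (p := p) (m := m)
          letI := W.residueModuleSucc (K := K) (p := p) hm
          ∀ (π : ∀ v : HeightOneSpectrum (𝓞 K), TamePin v) (L : Set (HeightOneSpectrum (𝓞 K)))
            (hL : L ⊆ (W.eisensteinTower (κ.unitTwist (-1)) hm).degreeTwoPrimes p) (hLS : ∀ v ∈ L, v ∉ S)
            (jbar' : AlgebraicClosure K →+* ℂ)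
            (c₀ : absoluteGaloisGroup ℚ) (σ : K ≃ₐ[ℚ] K) (hσ₁ : σ ≠ 1) (hσ : σ * σ = 1)
            (hτl : IsLiftOfAut σ (absGaloisTransport (K := ℚ) (L := K) c₀).toRingEquiv)
            (hτ₂ : Function.Involutive (absGaloisTransport (K := ℚ) (L := K) c₀).toRingEquiv)
            (D : ∀ k, DualityDatum p (ConjugationDatum.ofLifts σ hσ₁ hσ _ hτl hτ₂)
              ((W.eisensteinTower (κ.unitTwist (-1)) hm).ρ k) (IwasawaAlgebra.EisensteinCoeff p m (k + 1)))
            (e : ∀ j : ℕ, geomTorsion (W.baseChange K) ((p : ℤ) ^ j) →+ geomTorsion (W.baseChange K) ((p : ℤ) ^ j) →+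
              MuCarrier K (p ^ j))
            (log : ∀ j : ℕ, MuCarrier K (p ^ j) →+ ZMod (p ^ j)),
            IsComplexConjugation (Rat.castHom ℝ) c₀ →
            (∀ x, (ConjugationDatum.ofLifts σ hσ₁ hσ _ hτl hτ₂).τ x = absGaloisTransport (K := ℚ) (L := K) c₀ x) →
            (∀ k, (D k).e = ZpExtension.eisensteinDualityForm hm (k + 1)
              (conjPairing (e (k + 1)) ((ConjugationDatum.ofLifts σ hσ₁ hσ _ hτl hτ₂).isLift.torsionMap W _)
                (log (k + 1)))) →
            (∀ j a, e j a a = 0) →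
            (∀ j (g : absoluteGaloisGroup K) a b, e j (g • a) (g • b) = mu K (p ^ j) g (e j a b)) →
            (∀ j a b, e j ((ConjugationDatum.ofLifts σ hσ₁ hσ _ hτl hτ₂).isLift.torsionMap W _ a)
              ((ConjugationDatum.ofLifts σ hσ₁ hσ _ hτl hτ₂).isLift.torsionMap W _ b) = -e j a b) →
            (∀ j (a : geomTorsion (W.baseChange K) ((p : ℤ) ^ j)),
              (ConjugationDatum.ofLifts σ hσ₁ hσ _ hτl hτ₂).isLift.torsionMap W _
                ((ConjugationDatum.ofLifts σ hσ₁ hσ _ hτl hτ₂).isLift.torsionMap W _ a) = a) →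
            (∀ j, Function.Bijective (log j)) →
            (∀ j (g : absoluteGaloisGroup K) ξ, log j (mu K (p ^ j) g ξ) = cyclotomicCharacterModPow K p j g * log j ξ) →
              (((W.isQuotientBy_eisensteinDVRSetting_πbar (κ.unitTwist (-1)) hm S hpS hbad L hL hLS jbar'
                  (ConjugationDatum.ofLifts σ hσ₁ hσ _ hτl hτ₂) D
                  (W.eisensteinLevelsTameFs (κ.unitTwist (-1)) hm π S hpS hbad L hL hLS)
                  0).propagateStructure (W.eisensteinTowerTriple (κ.unitTwist (-1)) hm S hpS hbad L hL hLS 0).cond)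
                  (Sum.inr (σ • v))).map
                  (((W.residualTauGeomTorsion (p := p) (ConjugationDatum.ofLifts σ hσ₁ hσ _ hτl hτ₂) hm (k := 0 + 1)
                      (Nat.succ_pos 0)).thetaH1 (Sum.inr v)).comp
                    ((ConjugationDatum.ofLifts σ hσ₁ hσ _ hτl hτ₂).transportH1
                      ((W.baseChange K).torsionGaloisModule (p : ℤ)) v)) =
                ((W.isQuotientBy_eisensteinDVRSetting_πbar (κ.unitTwist (-1)) hm S hpS hbad L hL hLS jbar'
                  (ConjugationDatum.ofLifts σ hσ₁ hσ _ hτl hτ₂) D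
                  (W.eisensteinLevelsTameFs (κ.unitTwist (-1)) hm π S hpS hbad L hL hLS)
                  0).propagateStructure (W.eisensteinTowerTriple (κ.unitTwist (-1)) hm S hpS hbad L hL hLS 0).cond)
                  (Sum.inr v) := by
  intro N _ W _ K _ _ p _ κ γ hyp hirr hirrK S hpS hbad hSN hSσ v hvS hpv
  haveI := hyp.isElliptic
  have hK : IsImaginaryQuadratic K := hyp.isImaginaryQuadratic
  haveI : IsTotallyComplex K := hK.isTotallyComplex
  classical
  have hantiκ : (κ.unitTwist (-1)).IsAnticyclotomic := hyp.anticyclotomic.unitTwist (-1)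
  -- every place of `S` is finitely decomposed in `K_∞^−/K`: the (B4) elements `κ⁻(g_w) = p^{s_w}`
  have hdec : ∀ w ∈ S, ¬ (GreenbergSelmer.decomp w ≤ (κ.unitTwist (-1)).kerSubgroup) :=
    ZpExtension.decomp_not_le_kerSubgroup_of_mem_or_mem hK (κ.unitTwist (-1)) hantiκ hyp.heegner (NeZero.ne N) hSN
  have hsg : ∀ w ∈ S, ∃ (sw : ℕ) (g₀ : absoluteGaloisGroup (w.adicCompletion K)),
      ((κ.unitTwist (-1)) (absGaloisRestrict K (w.adicCompletion K) g₀)).toAdd = ((p ^ sw : ℕ) : ℤ_[p]) :=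
    fun w hw ↦
      ZpExtension.exists_toAdd_apply_absGaloisRestrict_eq_pow_of_not_decomp_le (κ.unitTwist (-1)) w (hdec w hw)
  choose! s g hg using hsg
  refine ⟨S.sup (fun w ↦ 5 * p ^ s w + 1), fun m hm hlt ↦ ?_⟩
  letI := IwasawaAlgebra.isDomain_quotient_X_pow_add_C p hm
  letI := IwasawaAlgebra.isDiscreteValuationRing_quotient_X_pow_add_C p hm
  haveI := IwasawaAlgebra.EisensteinCoeff.isLocalRing_succ p hm
  letI := IwasawaAlgebra.EisensteinCoeff.algebraOfSpecSucc p m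
  haveI := W.isScalarTower_algebraOfSpecSucc (K := K) (p := p) (m := m)
  letI := W.residueModuleSucc (K := K) (p := p) hm
  intro π L hL hLS jbar' c₀ σ hσ₁ hσ hτl hτ₂ D e log hc₀ hτ hDe h4' h5' h6' h7' h8' h9'
  -- `σ v ∈ S`, `p ∈ σ v`
  have hσvS : σ • v ∈ S := hSσ σ _ (by rwa [smul_smul, hσ, one_smul])
  have hpσv : ((p : ℕ) : 𝓞 K) ∈ (σ • v).asIdeal := (natCast_mem_smul_asIdeal_iff (K := K) (p := p) σ v).2 hpv
  have hloc : ∀ w ∈ ({v, (ConjugationDatum.ofLifts σ hσ₁ hσ _ hτl hτ₂).σ • v} : Set (HeightOneSpectrum (𝓞 K))),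
      w ∈ S ∧ ((p : ℕ) : 𝓞 K) ∈ w.asIdeal := by
    intro w hw
    rcases hw with hw | hw
    · rw [hw]
      exact ⟨hvS, hpv⟩
    · rw [Set.mem_singleton_iff] at hw
      rw [hw]
      exact ⟨hσvS, hpσv⟩
  -- good ORDINARY reduction of `E_K` at `w ∣ p`, from `hyp.ordinary`
  have hgood : ∀ w ∈ ({v, (ConjugationDatum.ofLifts σ hσ₁ hσ _ hτl hτ₂).σ • v} : Set (HeightOneSpectrum (𝓞 K))),
      (W.baseChange K).HasGoodReductionAt w :=
    fun w hw ↦ W.hasGoodReductionAt_baseChange_of_hasGoodReductionAtPrime hyp.ordinary.1 w (hloc w hw).2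
  have hord : ∀ w ∈ ({v, (ConjugationDatum.ofLifts σ hσ₁ hσ _ hτl hτ₂).σ • v} : Set (HeightOneSpectrum (𝓞 K))),
      ∃ P : localPoints (W.baseChange K) (w.adicCompletion K),
        (p : ℤ) • P = 0 ∧ P ∉ (W.baseChange K).localKernelOfReduction w :=
    fun w hw ↦ (W.baseChange K).exists_ordinaryPoint_local_of_not_dvd_frobeniusTraceAt w (hgood w hw) (hloc w hw).2
      (W.not_dvd_frobeniusTraceAt_baseChange_of_isOrdinaryAt hyp.ordinary w (hloc w hw).2)
  -- `κ⁻(τ⁻¹ g τ) = −κ⁻(g)` for the transported complex conjugation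
  have hanti : ∀ g' : absoluteGaloisGroup K,
      ((κ.unitTwist (-1)) ((ConjugationDatum.ofLifts σ hσ₁ hσ _ hτl hτ₂).conj g')).toAdd =
        -((κ.unitTwist (-1)) g').toAdd :=
    fun g' ↦ ZpExtension.toAdd_conjGalCMH_eq_neg (κ.unitTwist (-1)) hantiκ (fun w ↦ IsTotallyComplex.isComplex w)
      (ConjugationDatum.ofLifts σ hσ₁ hσ _ hτl hτ₂).isLift hc₀ hτ g'
  exact HF7 W (κ.unitTwist (-1)) hm S hpS hbad L hL hLS jbar' σ hσ₁ hσ _ hτl hτ₂ D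
    (W.eisensteinLevelsTameFs (κ.unitTwist (-1)) hm π S hpS hbad L hL hLS) hpv hpσv hgood hord hanti
    (fun w hw ↦ hg w (hloc w hw).1)
    (fun w hw ↦ (Finset.le_sup (f := fun w ↦ 5 * p ^ s w + 1) (hloc w hw).1).trans hlt.le)

end Summit.BirchSwinnertonDyer.BirchSwinnertonDyer.Theorems.HeegnerMuPartH5bAtS

end
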